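import Mathlib
import Summits.ValiantsHypothesis.ValiantsHypothesis.Theorems.GrenetZeonPolySizeQPAlgebraAdjugateLengthTwo
import HarnessLib

/-!
# Crux `GrenetZeon.PolySizeQPAlgebra` (stmt-ValiantsHypothesis-8064), line `vbp-slice-dealg` —
# the adjugate-length inequality `AL(q)` for DIAGONAL residual blocks, every `q`

The residual-corank-`q` count of input (B) of the `c = 1` box (hand memos on 8064, `…AdjugateLengthTwo`,
`…BlockNormalFormGeneral`) asks, after the normal form `A(p) ≃ diag(1_κ, S)` with `S ∈ Mat_q(𝔪)` and
`det S = 0`, for the inequality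

  `AL(q)`:  `ℓ(Col adj S) ≤ ℓ(R)`  (`Col adj S` = the `R`-span of the columns of `adj S`, `ℓ = dim_ℂ`),

which bounds the second-polarisation term `tr(adj S · (X₂₁Y₁₂ + Y₂₁X₁₂))` of the Hessian by `2·dim R` per
column of the unit block.  The tree has `AL(2)` (`finrank_range_mulVecLin_add_le_of_det_eq_zero`); for
`q ≥ 3` the memos report equality in exact computations and no proof.  This file proves `AL(q)` for every `q`
when the residual block is DIAGONAL, by a telescoping argument over the chain
`R ⊇ s_q R ⊇ s_{q-1}s_q R ⊇ ⋯ ⊇ s_1⋯s_q R = 0`: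

* `finrank_range_mulLeft_add_le` — if `c·a·b = 0` then `dim (cb)R + dim (ab)R ≤ dim bR`
  (multiplication by `c` maps `bR` onto `cbR` and kills `abR ⊆ bR`).
* `sum_finrank_range_mulLeft_cofactor_le` — **for `s_0, …, s_{q-1} ∈ R` with `∏ s_j = 0`:
  `Σ_i dim_ℂ (∏_{j ≠ i} s_j) R ≤ dim_ℂ R`** (`ℕ`-indexed; `…_fin` for `Fin q`).
* `finrank_range_adjugate_diagonal_le` — **`AL(q)` for diagonal blocks: for `S = diag(s)` with `det S = 0`,
  `dim_ℂ Col(adj S) ≤ dim_ℂ R`**, over ANY commutative algebra `R` of finite dimension over `ℂ` (no locality,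
  no Gorenstein hypothesis).

(The general `AL(q)` is equivalent, by Cayley–Hamilton, to `ℓ(g(S)·R^q) ≤ ℓ(R)` for `g(t) = χ_S(t)/t`; it is
attained with equality when `R^q` is a cyclic `R[S]`-module.  It remains open here for non-diagonalisable
`S`, `q ≥ 3`.)  HONEST FRAMING: linear algebra toward the residual-corank count of input (B); no stub of the
line is closed; VP ≠ VNP is not moved.

References: T. Mignon, N. Ressayre, IMRN 2004:79, §2 [MignonRessayre2004].
-/

noncomputable section

open Matrix

-- single-conjunct layout `Summits/ValiantsHypothesis/ValiantsHypothesis`: duplicated namespace by design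
set_option linter.dupNamespace false

namespace Summit.ValiantsHypothesis.ValiantsHypothesis.Theorems.GrenetZeonPolySizeQPAlgebra

variable {R : Type*} [CommRing R] [Algebra ℂ R] [Module.Finite ℂ R]

/-- **One telescoping step.**  If `c · a · b = 0` then `dim_ℂ (cb)R + dim_ℂ (ab)R ≤ dim_ℂ bR`:
multiplication by `c` maps `bR` onto `(cb)R` and kills `(ab)R ⊆ bR`. [folklore] -/
theorem finrank_range_mulLeft_add_le {a b c : R} (h : c * a * b = 0) :
    Module.finrank ℂ (LinearMap.range (LinearMap.mulLeft ℂ (c * b))) +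
      Module.finrank ℂ (LinearMap.range (LinearMap.mulLeft ℂ (a * b))) ≤
        Module.finrank ℂ (LinearMap.range (LinearMap.mulLeft ℂ b)) := by
  set Vb : Submodule ℂ R := LinearMap.range (LinearMap.mulLeft ℂ b) with hVb
  set g : Vb →ₗ[ℂ] R := LinearMap.mulLeft ℂ c ∘ₗ Vb.subtype with hg
  have hrange : LinearMap.range g = LinearMap.range (LinearMap.mulLeft ℂ (c * b)) := by
    rw [hg, LinearMap.range_comp, Submodule.range_subtype, hVb, LinearMap.mulLeft_mul,
      LinearMap.range_comp]
  have hker : LinearMap.range (LinearMap.mulLeft ℂ (a * b)) ≤ (LinearMap.ker g).map Vb.subtype := by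
    rintro x ⟨r, rfl⟩
    have hmem : a * b * r ∈ Vb := ⟨a * r, by rw [LinearMap.mulLeft_apply]; ring⟩
    refine ⟨⟨a * b * r, hmem⟩, LinearMap.mem_ker.2 ?_, rfl⟩
    show c * (a * b * r) = 0
    calc c * (a * b * r) = c * a * b * r := by ring
      _ = 0 := by rw [h, zero_mul]
  have hrn := LinearMap.finrank_range_add_finrank_ker g
  have hk : Module.finrank ℂ (LinearMap.range (LinearMap.mulLeft ℂ (a * b))) ≤
      Module.finrank ℂ (LinearMap.ker g) :=
    (Submodule.finrank_mono hker).trans_eq (Submodule.finrank_map_subtype_eq _ _)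
  rw [← hrange, ← hrn]
  exact Nat.add_le_add_left hk _

/-- **`AL(q)` for diagonal blocks, `ℕ`-indexed form.**  For `s : ℕ → R` with `∏_{j<q} s_j = 0`:
`Σ_{i<q} dim_ℂ ŝ_i R ≤ dim_ℂ R`, where `ŝ_i = (∏_{j<i} s_j)·(∏_{i<j<q} s_j)` is the `i`-th diagonal cofactor.
Telescoping over `R ⊇ s_{q-1}R ⊇ s_{q-2}s_{q-1}R ⊇ ⋯`. [folklore] -/
theorem sum_finrank_range_mulLeft_cofactor_le (s : ℕ → R) {q : ℕ}
    (hs : ∏ j ∈ Finset.range q, s j = 0) :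
    ∑ i ∈ Finset.range q, Module.finrank ℂ (LinearMap.range (LinearMap.mulLeft ℂ
      ((∏ j ∈ Finset.range i, s j) * ∏ j ∈ Finset.Ico (i + 1) q, s j))) ≤ Module.finrank ℂ R := by
  -- suffix products `P i = ∏_{i ≤ j < q} s_j`
  set P : ℕ → R := fun i => ∏ j ∈ Finset.Ico i q, s j with hP
  set d : R → ℕ := fun a => Module.finrank ℂ (LinearMap.range (LinearMap.mulLeft ℂ a)) with hd
  have hstep : ∀ i, i < q → d ((∏ j ∈ Finset.range i, s j) * P (i + 1)) + d (P i) ≤ d (P (i + 1)) := by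
    intro i hi
    have hPi : P i = s i * P (i + 1) := Finset.prod_eq_prod_Ico_succ_bot hi s
    have hzero : (∏ j ∈ Finset.range i, s j) * s i * P (i + 1) = 0 := by
      rw [mul_assoc, ← hPi, hP]
      simp only
      rw [Finset.prod_range_mul_prod_Ico s hi.le, hs]
    rw [hPi]
    exact finrank_range_mulLeft_add_le hzero
  -- telescoping by induction on `k ≤ q`
  have htel : ∀ k, k ≤ q →
      ∑ i ∈ Finset.range k, d ((∏ j ∈ Finset.range i, s j) * P (i + 1)) + d (P 0) ≤ d (P k) := by
    intro k
    induction k with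
    | zero => intro _; simp
    | succ k ih =>
        intro hk
        rw [Finset.sum_range_succ]
        have h1 := ih (Nat.le_of_succ_le hk)
        have h2 := hstep k hk
        omega
  have hPq : d (P q) = Module.finrank ℂ R := by
    show Module.finrank ℂ (LinearMap.range (LinearMap.mulLeft ℂ (∏ j ∈ Finset.Ico q q, s j))) = _
    rw [Finset.Ico_self, Finset.prod_empty, LinearMap.mulLeft_one, LinearMap.range_id, finrank_top]
  have := htel q le_rfl
  rw [hPq] at this
  exact le_trans (Nat.le_add_right _ _) this

omit [Algebra ℂ R] [Module.Finite ℂ R] in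
/-- The `i`-th diagonal cofactor as a product over `range q` with `i` erased. [folklore] -/
theorem prod_range_mul_prod_Ico_succ_eq_prod_erase (s : ℕ → R) {i q : ℕ} (hi : i < q) :
    (∏ j ∈ Finset.range i, s j) * ∏ j ∈ Finset.Ico (i + 1) q, s j =
      ∏ j ∈ (Finset.range q).erase i, s j := by
  have hunion : (Finset.range q).erase i = Finset.range i ∪ Finset.Ico (i + 1) q := by
    ext j
    simp only [Finset.mem_erase, Finset.mem_range, Finset.mem_union, Finset.mem_Ico]
    omega
  have hdisj : Disjoint (Finset.range i) (Finset.Ico (i + 1) q) := by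
    rw [Finset.disjoint_left]
    intro j h1 h2
    simp only [Finset.mem_range] at h1
    simp only [Finset.mem_Ico] at h2
    omega
  rw [hunion, Finset.prod_union hdisj]

/-- **`AL(q)` for diagonal blocks, `Fin q`-indexed form.**  For `v : Fin q → R` with `∏ v_i = 0`:
`Σ_i dim_ℂ (∏_{j ≠ i} v_j) R ≤ dim_ℂ R`. [folklore] -/
theorem sum_finrank_range_mulLeft_cofactor_le_fin {q : ℕ} (v : Fin q → R) (hv : ∏ i, v i = 0) :
    ∑ i : Fin q, Module.finrank ℂ (LinearMap.range (LinearMap.mulLeft ℂ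
      (∏ j ∈ Finset.univ.erase i, v j))) ≤ Module.finrank ℂ R := by
  classical
  -- extend `v` to `ℕ`
  set s : ℕ → R := fun j => if h : j < q then v ⟨j, h⟩ else 1 with hs
  have hsv : ∀ i : Fin q, s i = v i := fun i => by simp [hs, i.2]
  have hprod : ∏ j ∈ Finset.range q, s j = 0 := by
    rw [← hv, ← Fin.prod_univ_eq_prod_range]
    exact Finset.prod_congr rfl fun i _ => hsv i
  have herase : ∀ i : Fin q, ∏ j ∈ Finset.univ.erase i, v j = ∏ j ∈ (Finset.range q).erase i, s j := by
    intro i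
    have hL : ∏ j ∈ Finset.univ.erase i, v j =
        ∏ j : Fin q, (if (j : ℕ) = (i : ℕ) then (1 : R) else s j) := by
      rw [← Finset.prod_erase Finset.univ
        (f := fun j : Fin q => if (j : ℕ) = (i : ℕ) then (1 : R) else s j) (a := i) (if_pos rfl)]
      exact Finset.prod_congr rfl fun j hj => by
        rw [if_neg (fun h => (Finset.mem_erase.1 hj).1 (Fin.ext h)), hsv]
    have hR : ∏ j ∈ (Finset.range q).erase (i : ℕ), s j =
        ∏ j ∈ Finset.range q, (if j = (i : ℕ) then (1 : R) else s j) := by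
      rw [← Finset.prod_erase (Finset.range q)
        (f := fun j : ℕ => if j = (i : ℕ) then (1 : R) else s j) (a := (i : ℕ)) (if_pos rfl)]
      exact Finset.prod_congr rfl fun j hj => by rw [if_neg (Finset.mem_erase.1 hj).1]
    rw [hL, hR, ← Fin.prod_univ_eq_prod_range (fun j => if j = (i : ℕ) then (1 : R) else s j)]
  have hmain := sum_finrank_range_mulLeft_cofactor_le s hprod
  rw [← Fin.sum_univ_eq_sum_range] at hmain
  refine le_trans (le_of_eq (Finset.sum_congr rfl fun i _ => ?_)) hmain
  rw [herase i, prod_range_mul_prod_Ico_succ_eq_prod_erase s i.2]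

/-- The column module of a diagonal matrix has dimension `Σ_i dim_ℂ w_i R`. [folklore] -/
theorem finrank_range_mulVecLin_diagonal {q : ℕ} (w : Fin q → R) :
    Module.finrank ℂ (LinearMap.range ((Matrix.diagonal w).mulVecLin.restrictScalars ℂ)) =
      ∑ i : Fin q, Module.finrank ℂ (LinearMap.range (LinearMap.mulLeft ℂ (w i))) := by
  classical
  set V : Submodule ℂ (Fin q → R) :=
    LinearMap.range ((Matrix.diagonal w).mulVecLin.restrictScalars ℂ) with hV
  have hcoord : ∀ x : V, ∀ i, (x : Fin q → R) i ∈ LinearMap.range (LinearMap.mulLeft ℂ (w i)) := by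
    rintro ⟨x, ⟨y, rfl⟩⟩ i
    refine ⟨y i, ?_⟩
    simp only [LinearMap.mulLeft_apply, LinearMap.coe_restrictScalars, Matrix.mulVecLin_apply,
      Matrix.mulVec_diagonal]
  set Φ : V →ₗ[ℂ] (Π i : Fin q, LinearMap.range (LinearMap.mulLeft ℂ (w i))) :=
    LinearMap.pi fun i => LinearMap.codRestrict _ ((LinearMap.proj i).comp V.subtype)
      (fun x => hcoord x i) with hΦ
  have hΦapp : ∀ (x : V) i, ((Φ x i : LinearMap.range (LinearMap.mulLeft ℂ (w i))) : R) =
      (x : Fin q → R) i := fun x i => rfl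
  have hinj : Function.Injective Φ := by
    intro x y hxy
    apply Subtype.ext
    funext i
    have := congrArg (fun f => ((f i : LinearMap.range (LinearMap.mulLeft ℂ (w i))) : R)) hxy
    simpa [hΦapp] using this
  have hsurj : Function.Surjective Φ := by
    intro y
    have hy : ∀ i, ∃ r : R, w i * r = ((y i : LinearMap.range (LinearMap.mulLeft ℂ (w i))) : R) :=
      fun i => by
        obtain ⟨r, hr⟩ := (y i).2
        exact ⟨r, by rw [← hr, LinearMap.mulLeft_apply]⟩
    choose r hr using hy
    have hmem : (Matrix.diagonal w).mulVec r ∈ V :=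
      ⟨r, by simp only [LinearMap.coe_restrictScalars, Matrix.mulVecLin_apply]⟩
    refine ⟨⟨_, hmem⟩, ?_⟩
    funext i
    apply Subtype.ext
    rw [hΦapp]
    simp only [Matrix.mulVec_diagonal, hr]
  rw [LinearEquiv.finrank_eq (LinearEquiv.ofBijective Φ ⟨hinj, hsurj⟩), Module.finrank_pi_fintype]

/-- **`AL(q)` for DIAGONAL residual blocks.**  For a diagonal `q × q` matrix `S = diag(v)` over a commutative
algebra `R` of finite dimension over `ℂ` with `det S = 0`: the column module of `adj S` (the range of
`x ↦ adj S · x` on `R^q`, as a `ℂ`-space) has dimension `≤ dim_ℂ R`.  (`adj diag(v) = diag(∏_{j≠i} v_j)`,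
`Matrix.adjugate_diagonal`; then `sum_finrank_range_mulLeft_cofactor_le_fin`.) [folklore] -/
theorem finrank_range_adjugate_diagonal_le {q : ℕ} (v : Fin q → R)
    (hv : (Matrix.diagonal v).det = 0) :
    Module.finrank ℂ (LinearMap.range
      ((Matrix.diagonal v).adjugate.mulVecLin.restrictScalars ℂ)) ≤ Module.finrank ℂ R := by
  classical
  rw [Matrix.det_diagonal] at hv
  rw [Matrix.adjugate_diagonal, finrank_range_mulVecLin_diagonal]
  exact sum_finrank_range_mulLeft_cofactor_le_fin v hv

end Summit.ValiantsHypothesis.ValiantsHypothesis.Theorems.GrenetZeonPolySizeQPAlgebra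

end
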